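import Summits.Ventures.PercRepro.RankLevelSetSpanningThreeTriangles

/-!
# PercRepro — THE SPANNING TAIL CUT BY THE TRIANGLES, CELL-READY (p8 g14, S3)

On a matroid whose rank-`2` sets have at most `3` points, two distinct triangles share at most one point
(`inter_ncard_le_one_of_triangles`: otherwise their union is a rank-`2` set of `≥ 4` points). With `s₃ ≥ 2` (resp. `≥ 3`)
triangles, the spanning sets number at most
`Σ_{j ≤ d} C(n, j) + C(n − 5, d) − C(n − 6, d − 1) − 2·C(n − 3, d)` (**`ncard_spanning_le_of_two_triangles`**), resp.
`Σ_{j ≤ d} C(n, j) + 3·C(n − 5, d) − C(n − 9, d − 2) − C(n − 6, d − 1) − 3·C(n − 3, d) − C(n − 9, d)`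
(**`ncard_spanning_le_of_three_triangles`**), `n = |E|`, `d` the nullity — the hypothesis `hspan` of the cell
`c025_core_six_heavy_cell_sq27di2v_span`. Axioms: standard.
-/

namespace PercRepro

open Finset Set

variable {α : Type*}

namespace Matroid

variable {M : _root_.Matroid α} [M.Finite]

/-- A triangle (a circuit of three elements) has rank `2`. -/
theorem eRk_eq_two_of_triangle {T : Set α} (hT : M.IsCircuit T) (hc : T.ncard = 3) : M.eRk T = 2 := by
  have hTf : T.Finite := M.ground_finite.subset hT.subset_ground
  have h3 : T.encard = 3 := by rw [← hTf.cast_ncard_eq, hc]; rfl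
  have h := hT.eRk_add_one_eq
  rw [h3, show (3 : ℕ∞) = 2 + 1 by norm_num] at h
  exact WithTop.add_right_cancel WithTop.one_ne_top h

/-- **Two distinct triangles share at most one point** when every rank-`2` set has at most `3` points. -/
theorem inter_ncard_le_one_of_triangles (hC1 : ∀ L ⊆ M.E, M.eRk L = 2 → L.ncard ≤ 3)
    {T₁ T₂ : Set α} (h1 : M.IsCircuit T₁) (h2 : M.IsCircuit T₂) (hc1 : T₁.ncard = 3) (hc2 : T₂.ncard = 3)
    (hne : T₁ ≠ T₂) : (T₁ ∩ T₂).ncard ≤ 1 := by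
  by_contra h
  have h' := Nat.lt_of_not_le h
  have hT1f : T₁.Finite := M.ground_finite.subset h1.subset_ground
  have hT2f : T₂.Finite := M.ground_finite.subset h2.subset_ground
  have hUf : (T₁ ∪ T₂).Finite := hT1f.union hT2f
  have hui := Set.ncard_union_add_ncard_inter T₁ T₂ hT1f hT2f
  -- the intersection is a proper part of `T₁`: `|T₁ ∩ T₂| ≤ 2`
  have hint : (T₁ ∩ T₂).ncard ≤ 2 := by
    by_contra h3
    have h3' := Nat.lt_of_not_le h3
    have heq : T₁ ∩ T₂ = T₁ := Set.eq_of_subset_of_ncard_le Set.inter_subset_left (by omega) hT1f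
    have hsub : T₁ ⊆ T₂ := heq ▸ Set.inter_subset_right
    exact hne (h1.eq_of_subset_isCircuit h2 hsub)
  -- the union has `≤ 4` points and nullity `≥ 2`, so rank `2` — and then `≤ 3` points
  have hnull := eRk_union_add_two_le_of_two_triangles h1 h2 hne
  have hU4 : (T₁ ∪ T₂).ncard ≤ 4 := by omega
  have hr : M.eRk (T₁ ∪ T₂) ≤ 2 := by
    have h4 : (T₁ ∪ T₂).encard ≤ ((4 : ℕ) : ℕ∞) := by
      rw [← hUf.cast_ncard_eq]; exact_mod_cast hU4
    have := hnull.trans h4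
    rw [show ((4 : ℕ) : ℕ∞) = 2 + 2 by norm_num] at this
    exact (ENat.add_le_add_iff_right (by simp)).1 this
  have hr2 : M.eRk (T₁ ∪ T₂) = 2 := by
    refine le_antisymm hr ?_
    have := M.eRk_mono (Set.subset_union_left : T₁ ⊆ T₁ ∪ T₂)
    rwa [eRk_eq_two_of_triangle h1 hc1] at this
  have hle := hC1 (T₁ ∪ T₂) (Set.union_subset h1.subset_ground h2.subset_ground) hr2
  omega

/-- The triangles of a finite matroid form a finite family. -/
theorem triangles_finite : {C : Set α | M.IsCircuit C ∧ C.ncard = 3}.Finite :=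
  M.ground_finite.finite_subsets.subset (fun _ hC => hC.1.subset_ground)

/-- **THE SPANNING TAIL WITH `s₃ ≥ 2`**: on a matroid whose rank-`2` sets have `≤ 3` points, with `|E| = r(E) + d`,
`d ≥ 2`, `n = |E|` and at least two triangles,
`#spanning ≤ Σ_{j ≤ d} C(n, j) + C(n − 5, d) − C(n − 6, d − 1) − 2·C(n − 3, d)`. -/
theorem ncard_spanning_le_of_two_triangles (hC1 : ∀ L ⊆ M.E, M.eRk L = 2 → L.ncard ≤ 3)
    {d : ℕ} (hd : M.E.encard = M.eRank + d) (hd2 : 2 ≤ d)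
    (hs : 2 ≤ {C : Set α | M.IsCircuit C ∧ C.ncard = 3}.ncard) :
    {X : Set α | X ⊆ M.E ∧ M.eRk X = M.eRank}.ncard ≤
      ((∑ j ∈ Finset.range (d + 1), M.ground_finite.toFinset.card.choose j)
        + (M.ground_finite.toFinset.card - 5).choose d)
        - (M.ground_finite.toFinset.card - 6).choose (d - 1)
        - 2 * (M.ground_finite.toFinset.card - 3).choose d := by
  obtain ⟨T₁, T₂, hT1, hT2, hne⟩ := (Set.one_lt_ncard_iff (triangles_finite (M := M))).1 (by omega)
  have h12 := inter_ncard_le_one_of_triangles hC1 hT1.1 hT2.1 hT1.2 hT2.2 hne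
  have hT1f : T₁.Finite := M.ground_finite.subset hT1.1.subset_ground
  have hT2f : T₂.Finite := M.ground_finite.subset hT2.1.subset_ground
  have hui := Set.ncard_union_add_ncard_inter T₁ T₂ hT1f hT2f
  have hc1 : T₁.ncard = 3 := hT1.2
  have hc2 : T₂.ncard = 3 := hT2.2
  have hu : 5 ≤ (T₁ ∪ T₂).ncard := by omega
  have := ncard_spanning_le_two_triangles hd hd2 hT1.1 hT2.1 hne hT1.2 hT2.2 hu
  omega

/-- **THE SPANNING TAIL WITH `s₃ ≥ 3`**: with at least three triangles,
`#spanning ≤ Σ_{j ≤ d} C(n, j) + 3·C(n − 5, d) − C(n − 9, d − 2) − C(n − 6, d − 1) − 3·C(n − 3, d) − C(n − 9, d)`. -/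
theorem ncard_spanning_le_of_three_triangles (hC1 : ∀ L ⊆ M.E, M.eRk L = 2 → L.ncard ≤ 3)
    {d : ℕ} (hd : M.E.encard = M.eRank + d) (hd3 : 3 ≤ d)
    (hs : 3 ≤ {C : Set α | M.IsCircuit C ∧ C.ncard = 3}.ncard) :
    {X : Set α | X ⊆ M.E ∧ M.eRk X = M.eRank}.ncard ≤
      ((∑ j ∈ Finset.range (d + 1), M.ground_finite.toFinset.card.choose j)
        + 3 * (M.ground_finite.toFinset.card - 5).choose d)
        - (M.ground_finite.toFinset.card - 9).choose (d - 2)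
        - (M.ground_finite.toFinset.card - 6).choose (d - 1)
        - 3 * (M.ground_finite.toFinset.card - 3).choose d
        - (M.ground_finite.toFinset.card - 9).choose d := by
  obtain ⟨T₁, T₂, T₃, hT1, hT2, hT3, hne12, hne13, hne23⟩ :=
    (Set.two_lt_ncard_iff (triangles_finite (M := M))).1 (by omega)
  have h12 := inter_ncard_le_one_of_triangles hC1 hT1.1 hT2.1 hT1.2 hT2.2 hne12
  have h13 := inter_ncard_le_one_of_triangles hC1 hT1.1 hT3.1 hT1.2 hT3.2 hne13
  have h23 := inter_ncard_le_one_of_triangles hC1 hT2.1 hT3.1 hT2.2 hT3.2 hne23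
  have := ncard_spanning_le_three_triangles hd hd3 hT1.1 hT2.1 hT3.1 hT1.2 hT2.2 hT3.2 h12 h13 h23
  omega

end Matroid

end PercRepro
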